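import Summits.Langlands.Langlands.Theorems.PhantomRMYoshidaResiduallyYoshidaLiftingStablePlaneSaturation
import Summits.Langlands.Langlands.Theorems.PhantomRMYoshidaResiduallyYoshidaLiftingResidualPlaneOrientation
import HarnessLib
import Mathlib.LinearAlgebra.Matrix.Charpoly.Coeff
import Mathlib.Data.Matrix.ColumnRowPartitioned
import Mathlib.Algebra.Polynomial.Div

/-!
# Orientation rigidity of reducible realisers (stub `stub_reducibleRealiserOrientation`, design note N2) —
# line `sector-klingen-split`

Stub-worker file of lead prover-line-stmt-Langlands-13639-c4-0 (crux `ResiduallyYoshidaLifting`, stmt-Langlands-13639,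
skeleton rev 8, sub-goal N2), namespace `…SectorKlingenSplit.Fibre`.

**Statement (`stub_reducibleRealiserOrientation`).**  Let `ℤ̄_p = Valued.integer (PadicAlgCl p)` with fraction field
`ℚ̄_p = PadicAlgCl p` and a residue map `red : ℤ̄_p → k`; let `σ, σ' : Γ → GL₂(k)` be irreducible and `B` a NON-trivial
class (not a coboundary), and let `rint : Γ → GL₄(ℤ̄_p)` be an integral frame of a realiser: residually
`red ∘ rint = h (σ, B; 0, σ') h⁻¹` (blocks along `finSumFinEquiv : Fin 2 ⊕ Fin 2 ≃ Fin 4`).  If some `ℚ̄_p`-conjugate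
`Q⁻¹ rint Q` is block upper triangular `(τ, C; 0, τ')`, then for every `g` there are `P₁, P₂ ∈ ℤ̄_p[X]` with
`P₁ ↦ charpoly τ(g)` over `ℚ̄_p` and `P₁ ↦ charpoly σ(g)` over `k`, and `P₂ ↦ charpoly τ'(g)`, `P₂ ↦ charpoly σ'(g)`:
the sub of a reducible realiser reduces to the SUB `σ̄`, never to the quotient.

**Proof.**
1. The plane `W = Q(ℚ̄_p² ⊕ 0)` (column span of `M₁ = Q E`, `E` the inclusion of the first block) is `rint`-stable with
   action `τ`: `rint_K M₁ = M₁ τ` (first block column of `rint_K Q = Q (τ, C; 0, τ')`).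
2. `Fibre.stub_stablePlaneSaturation` (p155220) saturates it: an INTEGRAL basis `N = M₁ A` of `W` with an identity
   `2 × 2` block in rows `i ≠ j` and INTEGRAL action matrices `T g`, `rint g N = N T g`.  Over `ℚ̄_p`,
   `M₁ A T_K = rint_K M₁ A = M₁ τ A` and `M₁` is injective, so `A T_K = τ A`, `T_K = A⁻¹ τ A` and
   `charpoly T_K = charpoly τ` (`exists_saturatedPlane_charpoly`).
3. Residually `N̄ = red N` keeps the identity block (so is injective) and `red(rint g) N̄ = N̄ red(T g)`; by
   `Fibre.stub_residualPlaneOrientation` (p155179) `red T` is conjugate to `σ` (never `σ'`), so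
   `charpoly (red T g) = charpoly σ(g)` (`charpoly_map_red_of_identityRows`).
4. `P₁ = charpoly (T g)` (`Matrix.charpoly_map`).  `P₂ = charpoly (rint g) /ₘ P₁`: `charpoly (rint g)` maps to
   `charpoly τ · charpoly τ'` over `ℚ̄_p` (conjugation by `Q`, `Matrix.charpoly_reindex`,
   `Matrix.charpoly_fromBlocks_zero₂₁`) and to `charpoly σ · charpoly σ'` over `k` (conjugation by `h`); division by the
   MONIC `P₁` commutes with ring maps (`Polynomial.map_divByMonic`) and cancels the left factor
   (`Polynomial.mul_divByMonic_cancel_left`).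

Uses only Mathlib and the two landed stubs.  No new definitions; helper lemmas are stated for reuse by T8b/T8c.
-/

noncomputable section

open scoped Matrix

-- `Summit.Langlands.Langlands.…` (summit = sub-problem name, D-0017 layout) trips `dupNamespace` on every decl.
set_option linter.dupNamespace false
set_option autoImplicit false

namespace Summit.Langlands.Langlands.Cruxes.ResiduallyYoshidaLifting.SectorKlingenSplit.Fibre

open Literature.NumberTheory.GaloisRepresentations

/-! ### Generic matrix helpers (any commutative ring) -/

section Helpers

variable {F : Type*} [CommRing F]

/-- Conjugation invariance of the characteristic polynomial, `GL`-form `M N M⁻¹`. [folklore] -/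
theorem charpoly_val_mul_mul_inv_val {n : Type*} [Fintype n] [DecidableEq n] (M : GL n F) (N : Matrix n n F) :
    (M.val * N * (M⁻¹).val).charpoly = N.charpoly := by
  rw [Matrix.charpoly_mul_comm, ← Matrix.mul_assoc, Units.inv_mul, Matrix.one_mul]

/-- Conjugation invariance of the characteristic polynomial, `GL`-form `M⁻¹ N M`. [folklore] -/
theorem charpoly_inv_val_mul_mul_val {n : Type*} [Fintype n] [DecidableEq n] (M : GL n F) (N : Matrix n n F) :
    ((M⁻¹).val * N * M.val).charpoly = N.charpoly := by
  rw [Matrix.charpoly_mul_comm, ← Matrix.mul_assoc, Units.mul_inv, Matrix.one_mul]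

/-- Left cancellation of a matrix whose `mulVec` has trivial kernel. [folklore] -/
theorem mul_left_cancel_of_mulVec_ker {m n l : Type*} [Fintype n] [Fintype l] (M : Matrix m n F)
    (hM : ∀ a, M *ᵥ a = 0 → a = 0) {X Y : Matrix n l F} (h : M * X = M * Y) : X = Y := by
  rw [← sub_eq_zero]
  refine Matrix.ext_iff_mulVec.mpr fun v => ?_
  rw [Matrix.zero_mulVec]
  apply hM
  rw [Matrix.mulVec_mulVec, Matrix.mul_sub, h, sub_self, Matrix.zero_mulVec]

/-- Row reindexing commutes with right multiplication. [folklore] -/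
theorem submatrix_id_mul_eq {l m n o : Type*} [Fintype n] (M : Matrix m n F) (N : Matrix n o F) (e₁ : l → m) :
    M.submatrix e₁ id * N = (M * N).submatrix e₁ id := by
  rw [Matrix.submatrix_mul _ N _ id id Function.bijective_id, Matrix.submatrix_id_id]

end Helpers

/-! ### The stable plane of a block-upper-triangular conjugate, saturated over `ℤ̄_p` -/

section Integral

variable {p : ℕ} [Fact p.Prime]

/-- **Steps 1–2.**  If `rint_K Q = Q (τ, C; 0, τ')` for integral `rint g` and `Q ∈ GL₄(ℚ̄_p)`, then the plane
`Q(ℚ̄_p² ⊕ 0)` has an INTEGRAL basis `N` with an identity `2 × 2` block in rows `i, j` and INTEGRAL action matrices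
`T g` (`rint g N = N T g`) whose characteristic polynomials over `ℚ̄_p` are those of `τ g`. [folklore] -/
theorem exists_saturatedPlane_charpoly (Γ : Type)
    (rint : Γ → Matrix (Fin 4) (Fin 4) (Valued.integer (PadicAlgCl p))) (Q : GL (Fin 4) (PadicAlgCl p))
    (τ τ' C : Γ → Matrix (Fin 2) (Fin 2) (PadicAlgCl p))
    (hRK : ∀ g, (rint g).map (Valued.integer (PadicAlgCl p)).subtype * Q.val =
      Q.val * Matrix.reindex finSumFinEquiv finSumFinEquiv (Matrix.fromBlocks (τ g) (C g) 0 (τ' g))) :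
    ∃ (N : Matrix (Fin 4) (Fin 2) (Valued.integer (PadicAlgCl p))) (i j : Fin 4)
      (T : Γ → Matrix (Fin 2) (Fin 2) (Valued.integer (PadicAlgCl p))),
      N i 0 = 1 ∧ N i 1 = 0 ∧ N j 0 = 0 ∧ N j 1 = 1 ∧ (∀ g, rint g * N = N * T g) ∧
      ∀ g, ((T g).map (Valued.integer (PadicAlgCl p)).subtype).charpoly = (τ g).charpoly := by
  -- the inclusion `E : ℚ̄_p⁴ˣ²` of the first block `ℚ̄_p² ⊕ 0` along `finSumFinEquiv`, and `M₁ := Q E`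
  obtain ⟨E, hE⟩ : ∃ E : Matrix (Fin 4) (Fin 2) (PadicAlgCl p),
      E = (Matrix.fromRows (1 : Matrix (Fin 2) (Fin 2) (PadicAlgCl p))
        (0 : Matrix (Fin 2) (Fin 2) (PadicAlgCl p))).submatrix finSumFinEquiv.symm id :=
    ⟨_, rfl⟩
  have hblkE : ∀ g, Matrix.reindex finSumFinEquiv finSumFinEquiv (Matrix.fromBlocks (τ g) (C g) 0 (τ' g)) * E =
      E * τ g := fun g => by
    have eL : Matrix.reindex finSumFinEquiv finSumFinEquiv (Matrix.fromBlocks (τ g) (C g) 0 (τ' g)) * E =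
        (Matrix.fromRows (τ g) (0 : Matrix (Fin 2) (Fin 2) (PadicAlgCl p))).submatrix finSumFinEquiv.symm id := by
      rw [hE, Matrix.reindex_apply, Matrix.submatrix_mul_equiv, Matrix.fromBlocks_mul_fromRows]
      simp only [Matrix.mul_one, Matrix.mul_zero, add_zero]
    have eR : E * τ g =
        (Matrix.fromRows (τ g) (0 : Matrix (Fin 2) (Fin 2) (PadicAlgCl p))).submatrix finSumFinEquiv.symm id := by
      rw [hE, submatrix_id_mul_eq, Matrix.fromRows_mul, Matrix.one_mul, Matrix.zero_mul]
    rw [eL, eR]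
  have hEmul : ∀ a : Fin 2 → PadicAlgCl p,
      E *ᵥ a = ((Matrix.fromRows (1 : Matrix (Fin 2) (Fin 2) (PadicAlgCl p))
        (0 : Matrix (Fin 2) (Fin 2) (PadicAlgCl p))) *ᵥ a) ∘ finSumFinEquiv.symm := fun a => by
    rw [hE]
    rfl
  have hEa : ∀ (a : Fin 2 → PadicAlgCl p) (c : Fin 2),
      (E *ᵥ a) (finSumFinEquiv (Sum.inl c : Fin 2 ⊕ Fin 2)) = a c := fun a c => by
    rw [hEmul, Function.comp_apply, Equiv.symm_apply_apply, Matrix.fromRows_mulVec, Sum.elim_inl,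
      Matrix.one_mulVec]
  obtain ⟨M₁, hM₁⟩ : ∃ M₁ : Matrix (Fin 4) (Fin 2) (PadicAlgCl p), M₁ = Q.val * E := ⟨_, rfl⟩
  -- `M₁` is injective (columns of an invertible matrix)
  have hinj : ∀ a : Fin 2 → PadicAlgCl p, M₁ *ᵥ a = 0 → a = 0 := fun a ha => by
    have hEa0 : E *ᵥ a = 0 := by
      have e1 : (Q⁻¹).val *ᵥ (M₁ *ᵥ a) = E *ᵥ a := by
        rw [hM₁, Matrix.mulVec_mulVec, ← Matrix.mul_assoc, Units.inv_mul, Matrix.one_mul]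
      rw [← e1, ha, Matrix.mulVec_zero]
    funext c
    rw [← hEa a c, hEa0]
    rfl
  -- the plane is stable with action `τ`
  have hstab' : ∀ g, (rint g).map (Valued.integer (PadicAlgCl p)).subtype * M₁ = M₁ * τ g := fun g => by
    rw [hM₁, ← Matrix.mul_assoc, hRK g, Matrix.mul_assoc, hblkE g, ← Matrix.mul_assoc]
  have hstab : ∀ g, ∃ T₀ : Matrix (Fin 2) (Fin 2) (PadicAlgCl p),
      (rint g).map (Valued.integer (PadicAlgCl p)).subtype * M₁ = M₁ * T₀ := fun g => ⟨τ g, hstab' g⟩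
  -- saturation over `ℤ̄_p`
  obtain ⟨N, A, i, j, T, -, hNi0, hNi1, hNj0, hNj1, hA, hNA, hT⟩ :=
    stub_stablePlaneSaturation p Γ rint M₁ hinj hstab
  refine ⟨N, i, j, T, hNi0, hNi1, hNj0, hNj1, hT, fun g => ?_⟩
  -- `A T_K = τ A`, so `T_K = A⁻¹ (τ A)` and the characteristic polynomials agree
  have hAT : A * (T g).map (Valued.integer (PadicAlgCl p)).subtype = τ g * A := by
    apply mul_left_cancel_of_mulVec_ker M₁ hinj
    rw [← Matrix.mul_assoc, ← hNA, ← Matrix.map_mul, ← hT g, Matrix.map_mul, hNA, ← Matrix.mul_assoc, hstab' g,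
      Matrix.mul_assoc]
  have hTk : (T g).map (Valued.integer (PadicAlgCl p)).subtype = A⁻¹ * (τ g * A) := by
    rw [← hAT, ← Matrix.mul_assoc, Matrix.nonsing_inv_mul A hA, Matrix.one_mul]
  rw [hTk, Matrix.charpoly_mul_comm, Matrix.mul_assoc, Matrix.mul_nonsing_inv A hA, Matrix.mul_one]

/-! ### Residual orientation of the saturated plane -/

/-- **Step 3.**  An integral `N : ℤ̄_p⁴ˣ²` with an identity `2 × 2` block in rows `i, j`, spanning an `rint`-stable plane
with integral action `T` (`rint g N = N T g`), where `rint` reduces to the realised non-split `h (σ, B; 0, σ') h⁻¹`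
(`σ, σ'` irreducible, `B` not a coboundary): the reduction of `T g` has the characteristic polynomial of `σ g` — by the
residual orientation rigidity `stub_residualPlaneOrientation` applied to `red N` (still of rank `2`). [folklore] -/
theorem charpoly_map_red_of_identityRows {k : Type} [Field k] (Γ : Type) [Group Γ]
    (red : Valued.integer (PadicAlgCl p) →+* k) (σ σ' : Γ →* GL (Fin 2) k)
    (hσ : Representation.IsIrreducible ((glStdRepresentation (Fin 2) k).comp σ))
    (hσ' : Representation.IsIrreducible ((glStdRepresentation (Fin 2) k).comp σ'))
    (B : Γ → Matrix (Fin 2) (Fin 2) k)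
    (hB : ¬ ∃ X : Matrix (Fin 2) (Fin 2) k, ∀ g, B g = (σ g).val * X - X * (σ' g).val)
    (rint : Γ → Matrix (Fin 4) (Fin 4) (Valued.integer (PadicAlgCl p))) (h : GL (Fin 4) k)
    (hred : ∀ g, (rint g).map red = h.val * Matrix.reindex finSumFinEquiv finSumFinEquiv
        (Matrix.fromBlocks (σ g).val (B g) 0 (σ' g).val) * (h⁻¹).val)
    (N : Matrix (Fin 4) (Fin 2) (Valued.integer (PadicAlgCl p))) (i j : Fin 4)
    (T : Γ → Matrix (Fin 2) (Fin 2) (Valued.integer (PadicAlgCl p)))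
    (hNi0 : N i 0 = 1) (hNi1 : N i 1 = 0) (hNj0 : N j 0 = 0) (hNj1 : N j 1 = 1)
    (hT : ∀ g, rint g * N = N * T g) (g : Γ) :
    ((T g).map red).charpoly = (σ g).val.charpoly := by
  -- `red N` keeps the identity block, hence has rank `2`
  have hinj : ∀ a : Fin 2 → k, N.map red *ᵥ a = 0 → a = 0 := fun a ha => by
    have hi := congrFun ha i
    have hj := congrFun ha j
    simp only [Matrix.mulVec, dotProduct, Fin.sum_univ_two, Matrix.map_apply, hNi0, hNi1, hNj0, hNj1, map_one,
      map_zero, one_mul, zero_mul, add_zero, zero_add, Pi.zero_apply] at hi hj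
    funext c
    fin_cases c
    · exact hi
    · exact hj
  -- the residual plane is stable under the realised non-split extension
  have hstab : ∀ g, h.val * Matrix.reindex finSumFinEquiv finSumFinEquiv
      (Matrix.fromBlocks (σ g).val (B g) 0 (σ' g).val) * (h⁻¹).val * N.map red = N.map red * (T g).map red :=
    fun g => by rw [← hred g, ← Matrix.map_mul, hT g, Matrix.map_mul]
  obtain ⟨Ab, hAb⟩ :=
    stub_residualPlaneOrientation k Γ σ σ' hσ hσ' B hB h (N.map red) (fun g => (T g).map red) hinj hstab
  have hAbg : (σ g).val * Ab.val = Ab.val * (T g).map red := hAb g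
  have hTb : (T g).map red = (Ab⁻¹).val * ((σ g).val * Ab.val) := by
    rw [hAbg, ← Matrix.mul_assoc, Units.inv_mul, Matrix.one_mul]
  rw [hTb, Matrix.charpoly_mul_comm, Matrix.mul_assoc, Units.mul_inv, Matrix.mul_one]

end Integral

/-! ### Registered form -/

section Registered

/-- **Registered sub-goal N2 `stub_reducibleRealiserOrientation`** (crux stmt-Langlands-13639, line `sector-klingen-split`,
skeleton rev 8 = design note N2 verbatim): if an integral frame `rint` of a realiser of the NON-trivial class `B`
(sub `σ̄`, quotient `σ̄'`) is block UPPER triangular `(τ, C; 0, τ')` after a `GL₄(ℚ̄_p)`-conjugation, then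
`charpoly τ(g)` is an integral polynomial REDUCING TO `charpoly σ̄(g)` and `charpoly τ'(g)` one reducing to
`charpoly σ̄'(g)` — never the other way round (ORIENTATION RIGIDITY of reducible realisers). [folklore] -/
theorem stub_reducibleRealiserOrientation :
    ∀ (p : ℕ) [Fact p.Prime] (k : Type) [Field k] (Γ : Type) [Group Γ]
      (red : Valued.integer (PadicAlgCl p) →+* k) (σ σ' : Γ →* GL (Fin 2) k),
      Representation.IsIrreducible ((glStdRepresentation (Fin 2) k).comp σ) →
      Representation.IsIrreducible ((glStdRepresentation (Fin 2) k).comp σ') →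
      ∀ (B : Γ → Matrix (Fin 2) (Fin 2) k),
      (¬ ∃ X : Matrix (Fin 2) (Fin 2) k, ∀ g, B g = (σ g).val * X - X * (σ' g).val) →
      ∀ (rint : Γ →* GL (Fin 4) (Valued.integer (PadicAlgCl p))) (h : GL (Fin 4) k),
      (∀ g, (Matrix.GeneralLinearGroup.map red (rint g)).val =
          h.val * Matrix.reindex finSumFinEquiv finSumFinEquiv
            (Matrix.fromBlocks (σ g).val (B g) 0 (σ' g).val) * (h⁻¹).val) →
      ∀ (Q : GL (Fin 4) (PadicAlgCl p)) (τ τ' C : Γ → Matrix (Fin 2) (Fin 2) (PadicAlgCl p)),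
      (∀ g, ((Q⁻¹ * Matrix.GeneralLinearGroup.map (Valued.integer (PadicAlgCl p)).subtype (rint g) * Q :
            GL (Fin 4) (PadicAlgCl p)) : Matrix (Fin 4) (Fin 4) (PadicAlgCl p)) =
          Matrix.reindex finSumFinEquiv finSumFinEquiv (Matrix.fromBlocks (τ g) (C g) 0 (τ' g))) →
      ∀ g, ∃ P₁ P₂ : Polynomial (Valued.integer (PadicAlgCl p)),
        P₁.map (Valued.integer (PadicAlgCl p)).subtype = (τ g).charpoly ∧ P₁.map red = (σ g).val.charpoly ∧
        P₂.map (Valued.integer (PadicAlgCl p)).subtype = (τ' g).charpoly ∧ P₂.map red = (σ' g).val.charpoly := by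
  intro p _ k _ Γ _ red σ σ' hσ hσ' B hB rint h hred Q τ τ' C hQ g
  -- the two reductions of the integral frame, as plain matrix families
  have hmapK : ∀ g, (Matrix.GeneralLinearGroup.map (Valued.integer (PadicAlgCl p)).subtype (rint g)).val =
      (rint g).val.map (Valued.integer (PadicAlgCl p)).subtype := fun g => rfl
  have hred' : ∀ g, (rint g).val.map red = h.val * Matrix.reindex finSumFinEquiv finSumFinEquiv
      (Matrix.fromBlocks (σ g).val (B g) 0 (σ' g).val) * (h⁻¹).val := fun g => hred g
  have hQ' : ∀ g, (Q⁻¹).val * (rint g).val.map (Valued.integer (PadicAlgCl p)).subtype * Q.val =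
      Matrix.reindex finSumFinEquiv finSumFinEquiv (Matrix.fromBlocks (τ g) (C g) 0 (τ' g)) := fun g => by
    rw [← hmapK g, ← Units.val_mul, ← Units.val_mul]
    exact hQ g
  have hRK : ∀ g, (rint g).val.map (Valued.integer (PadicAlgCl p)).subtype * Q.val =
      Q.val * Matrix.reindex finSumFinEquiv finSumFinEquiv (Matrix.fromBlocks (τ g) (C g) 0 (τ' g)) := fun g => by
    rw [← hQ' g, ← Matrix.mul_assoc, ← Matrix.mul_assoc, Units.mul_inv, Matrix.one_mul]
  -- Steps 1–3
  obtain ⟨N, i, j, T, hNi0, hNi1, hNj0, hNj1, hT, hTK⟩ :=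
    exists_saturatedPlane_charpoly Γ (fun g => (rint g).val) Q τ τ' C hRK
  have hTk : ((T g).map red).charpoly = (σ g).val.charpoly :=
    charpoly_map_red_of_identityRows Γ red σ σ' hσ hσ' B hB (fun g => (rint g).val) h hred' N i j T
      hNi0 hNi1 hNj0 hNj1 hT g
  -- Step 4: the `4 × 4` characteristic polynomial factorises over `ℚ̄_p` and over `k`
  have h4K : ((rint g).val.map (Valued.integer (PadicAlgCl p)).subtype).charpoly =
      (τ g).charpoly * (τ' g).charpoly := by
    rw [← charpoly_inv_val_mul_mul_val Q ((rint g).val.map (Valued.integer (PadicAlgCl p)).subtype), hQ' g,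
      Matrix.charpoly_reindex, Matrix.charpoly_fromBlocks_zero₂₁]
  have h4k : ((rint g).val.map red).charpoly = (σ g).val.charpoly * (σ' g).val.charpoly := by
    rw [hred' g, charpoly_val_mul_mul_inv_val, Matrix.charpoly_reindex, Matrix.charpoly_fromBlocks_zero₂₁]
  refine ⟨(T g).charpoly, (rint g).val.charpoly /ₘ (T g).charpoly, ?_, ?_, ?_, ?_⟩
  · rw [← Matrix.charpoly_map, hTK g]
  · rw [← Matrix.charpoly_map, hTk]
  · rw [Polynomial.map_divByMonic _ (Matrix.charpoly_monic _), ← Matrix.charpoly_map, ← Matrix.charpoly_map, h4K,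
      hTK g, Polynomial.mul_divByMonic_cancel_left _ (Matrix.charpoly_monic _)]
  · rw [Polynomial.map_divByMonic _ (Matrix.charpoly_monic _), ← Matrix.charpoly_map, ← Matrix.charpoly_map, h4k,
      hTk, Polynomial.mul_divByMonic_cancel_left _ (Matrix.charpoly_monic _)]

end Registered

end Summit.Langlands.Langlands.Cruxes.ResiduallyYoshidaLifting.SectorKlingenSplit.Fibre

end
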